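import Summits.QuantumFields.YangMills.Theorems.FemtoTransferGapSpectralSumsRoot
import HarnessLib

/-!
# BLOCK-TO-FINE ROOT INEQUALITIES, part 4a: POINTWISE lemmas of the CROSS door (affine expansion of `X ↦ X^{1/ℓ}`)
# (crux idea «block-endpoint» on crux `DressedRitz`, stmt-QuantumFields-20205; LEAD prover ym-lead-20205-polyakovlift g4)

For TWO once-dressed vectors `u = K^ℓ ũ`, `u' = K^ℓ ũ'` with coefficient sequences `a_k`, `b_k` on one eigen-sequence (`λ_k ≥ 0`), the fine symmetrised coupling
(clause (o6)/(A6′) of line «polyakovlift») is `c = Σ_k a_k b_k λ_k^{2ℓ}(λ_k − m̄)`, `m̄` the mean of the two fine Rayleigh quotients.  Expanding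
`λ = m̄·(X/X₀)^{1/ℓ}`, `X = λ^ℓ`, `X₀ = m̄^ℓ`, affinely at `X₀`:  `λ − m̄ = (m̄/ℓ)(X/X₀ − 1) + m̄·E(X/X₀)` with the concave remainder `E ≤ 0`,

* `Root.affine_remainder_near`: `X₀² t²·|E(t)| ≤ …` — for `t = s^ℓ ∈ [1/(8Θ), Θ]`: `0 ≤ −E ≤ (32Θ²/ℓ)(t−1)²`; `Root.affine_remainder_far`: for `t ≤ 1/(8Θ)`:
  `t²·(−E) ≤ (8Θ/ℓ)·(t−ρ)²` whenever `ρ ≥ 1/(4Θ)`;  ★ `Root.cross_pointwise`: `t²|s − 1 − (t−1)/ℓ| ≤ (1/ℓ)(32Θ² t²(t−1)² + 8Θ (t−ρ)²)` on `0 ≤ t ≤ Θ`;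
* `Root.cross_term_bound` (per-atom bound of the cross integrand by AM–GM), `Root.cross_major_bound` (the dominating sum in terms of the two block defects and the
  mismatch of the block mean with the common centre); the summed door `SpecSum.cross_door` is in part 4b (`FemtoTransferGapSpectralSumsRootCross`).

HONEST FRAMING: real-analysis plumbing for the femto-universe infrastructure of the CONDITIONAL rung R2b1; nothing here bears on infinite volume, the continuum limit or
the Clay gap.  References: Reed–Simon IV, Thm. XIII.1 [cite: ReedSimonIV1978, Thm. XIII.1]; Bernoulli's inequality [folklore].
-/

set_option autoImplicit false

noncomputable section

open Finset
open scoped BigOperators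

namespace Summit.QuantumFields.YangMills.Theorems.FemtoTransferGap.SpecSum

namespace Root

/-! ## §1 Pointwise: the affine remainder of the `ℓ`-th root -/

/-- Bernoulli, summed: for `s ≥ 0`, `Σ_{i<ℓ} (1 − s^i) ≤ (1 − s)·Σ_{i<ℓ} i`. [folklore] -/
theorem sum_one_sub_pow_le {s : ℝ} (hs : 0 ≤ s) (ℓ : ℕ) :
    ∑ i ∈ range ℓ, (1 - s ^ i) ≤ (1 - s) * ∑ i ∈ range ℓ, (i : ℝ) := by
  rw [Finset.mul_sum]
  refine Finset.sum_le_sum fun i _ => ?_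
  have h := one_add_mul_le_pow (show (-2 : ℝ) ≤ s - 1 by linarith) i
  rw [show 1 + (s - 1) = s by ring] at h
  linarith

/-- `Σ_{i<ℓ} i ≤ ℓ²/2` (real form). [folklore] -/
theorem sum_range_cast_le (ℓ : ℕ) : ∑ i ∈ range ℓ, (i : ℝ) ≤ (ℓ : ℝ) ^ 2 / 2 := by
  have h : ∑ i ∈ range ℓ, (i : ℝ) = ((∑ i ∈ range ℓ, i : ℕ) : ℝ) := by push_cast; rfl
  rw [h, Finset.sum_range_id]
  have h2 : ((ℓ * (ℓ - 1) / 2 : ℕ) : ℝ) ≤ (ℓ : ℝ) * (ℓ - 1 : ℕ) / 2 := by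
    rw [le_div_iff₀ (by norm_num : (0:ℝ) < 2)]
    have := Nat.div_mul_le_self (ℓ * (ℓ - 1)) 2
    exact_mod_cast this
  rcases Nat.eq_zero_or_pos ℓ with h0 | hpos
  · subst h0; simp
  · have h3 : ((ℓ - 1 : ℕ) : ℝ) = (ℓ : ℝ) - 1 := by rw [Nat.cast_sub hpos]; simp
    rw [h3] at h2
    nlinarith [h2, show (0:ℝ) ≤ ℓ from Nat.cast_nonneg ℓ]

/-- CONCAVITY SIGN: `s ≤ 1 + (s^ℓ − 1)/ℓ` for `s ≥ 0`, `ℓ ≥ 1` (tangent of the concave `ℓ`-th root at `1`; Bernoulli). [folklore] -/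
theorem root_le_tangent {s : ℝ} (hs : 0 ≤ s) {ℓ : ℕ} (hℓ : 1 ≤ ℓ) : s ≤ 1 + (s ^ ℓ - 1) / ℓ := by
  have hℓpos : (0 : ℝ) < ℓ := by exact_mod_cast hℓ
  have h := one_add_mul_le_pow (show (-2 : ℝ) ≤ s - 1 by linarith) ℓ
  rw [show 1 + (s - 1) = s by ring] at h
  have h2 : s - 1 ≤ (s ^ ℓ - 1) / ℓ := by
    rw [le_div_iff₀ hℓpos]; linarith
  linarith

/-- NEAR remainder, below the centre: for `0 ≤ s ≤ 1` with `θ₀ ≤ s^ℓ` (`0 < θ₀`): `1 + (s^ℓ−1)/ℓ − s ≤ (s^ℓ − 1)²/(2ℓθ₀²)`. [folklore] -/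
theorem affine_remainder_below {s θ₀ : ℝ} (hs : 0 ≤ s) (hs1 : s ≤ 1) (hθ : 0 < θ₀) {ℓ : ℕ} (hℓ : 1 ≤ ℓ) (ht : θ₀ ≤ s ^ ℓ) :
    1 + (s ^ ℓ - 1) / ℓ - s ≤ (s ^ ℓ - 1) ^ 2 / (2 * ℓ * θ₀ ^ 2) := by
  have hℓpos : (0 : ℝ) < ℓ := by exact_mod_cast hℓ
  -- geometric sum G = Σ_{i<ℓ} s^i; s^ℓ − 1 = (s−1)G; 1 + (s^ℓ−1)/ℓ − s = (1−s)(ℓ − G)/ℓ = (1−s)Σ(1−s^i)/ℓ ≤ (1−s)² Σ i/ℓ ≤ (1−s)² ℓ/2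
  have hgeom : (∑ i ∈ range ℓ, s ^ i) * (s - 1) = s ^ ℓ - 1 := geom_sum_mul s ℓ
  have hcard : (∑ _i ∈ range ℓ, (1 : ℝ)) = ℓ := by simp
  have hid : 1 + (s ^ ℓ - 1) / ℓ - s = (1 - s) * (∑ i ∈ range ℓ, (1 - s ^ i)) / ℓ := by
    rw [Finset.sum_sub_distrib, hcard, ← hgeom]; field_simp; ring
  have hB := sum_one_sub_pow_le hs ℓ
  have hI := sum_range_cast_le ℓ
  have h1s : 0 ≤ 1 - s := by linarith
  have hup : 1 + (s ^ ℓ - 1) / ℓ - s ≤ (1 - s) ^ 2 * ℓ / 2 := by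
    rw [hid, div_le_iff₀ hℓpos]
    have := mul_le_mul_of_nonneg_left (le_trans hB (mul_le_mul_of_nonneg_left hI h1s)) h1s
    nlinarith [this]
  -- (1 − s) ℓ θ₀ ≤ 1 − s^ℓ : each s^i ≥ s^ℓ ≥ θ₀... use G ≥ ℓ s^{ℓ-1} ≥ ℓ θ₀
  have hG : (ℓ : ℝ) * θ₀ ≤ ∑ i ∈ range ℓ, s ^ i := by
    have : ∀ i ∈ range ℓ, θ₀ ≤ s ^ i := fun i hi =>
      le_trans ht (pow_le_pow_of_le_one hs hs1 (mem_range.1 hi).le)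
    calc (ℓ : ℝ) * θ₀ = ∑ _i ∈ range ℓ, θ₀ := by simp
      _ ≤ _ := Finset.sum_le_sum this
  have hkey : (1 - s) * (ℓ * θ₀) ≤ 1 - s ^ ℓ := by
    have := mul_le_mul_of_nonneg_left hG h1s
    nlinarith [this, hgeom]
  have hsq : (1 - s) ^ 2 * (ℓ * θ₀) ^ 2 ≤ (s ^ ℓ - 1) ^ 2 := by
    have h0 : 0 ≤ (1 - s) * (ℓ * θ₀) := by positivity
    calc (1 - s) ^ 2 * (ℓ * θ₀) ^ 2 = ((1 - s) * (ℓ * θ₀)) ^ 2 := by ring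
      _ ≤ (1 - s ^ ℓ) ^ 2 := pow_le_pow_left₀ h0 hkey 2
      _ = (s ^ ℓ - 1) ^ 2 := by ring
  calc 1 + (s ^ ℓ - 1) / ℓ - s ≤ (1 - s) ^ 2 * ℓ / 2 := hup
    _ = (1 - s) ^ 2 * (ℓ * θ₀) ^ 2 / (2 * ℓ * θ₀ ^ 2) := by field_simp
    _ ≤ (s ^ ℓ - 1) ^ 2 / (2 * ℓ * θ₀ ^ 2) := div_le_div_of_nonneg_right hsq (by positivity)

/-- NEAR remainder, above the centre: for `1 ≤ s` with `s^ℓ ≤ Θ`: `1 + (s^ℓ−1)/ℓ − s ≤ Θ(s^ℓ − 1)²/(2ℓ)`. [folklore] -/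
theorem affine_remainder_above {s Θ : ℝ} (hs1 : 1 ≤ s) {ℓ : ℕ} (hℓ : 1 ≤ ℓ) (ht : s ^ ℓ ≤ Θ) :
    1 + (s ^ ℓ - 1) / ℓ - s ≤ Θ * (s ^ ℓ - 1) ^ 2 / (2 * ℓ) := by
  have hℓpos : (0 : ℝ) < ℓ := by exact_mod_cast hℓ
  have hs : 0 ≤ s := by linarith
  have hΘ1 : 1 ≤ Θ := le_trans (one_le_pow₀ hs1) ht
  have hgeom : (∑ i ∈ range ℓ, s ^ i) * (s - 1) = s ^ ℓ - 1 := geom_sum_mul s ℓ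
  have hcard : (∑ _i ∈ range ℓ, (1 : ℝ)) = ℓ := by simp
  -- 1 + (s^ℓ−1)/ℓ − s = (s−1)(G − ℓ)/ℓ = (s−1) Σ(s^i − 1)/ℓ and s^i − 1 ≤ i (s−1) Θ
  have hid : 1 + (s ^ ℓ - 1) / ℓ - s = (s - 1) * (∑ i ∈ range ℓ, (s ^ i - 1)) / ℓ := by
    rw [Finset.sum_sub_distrib, hcard, ← hgeom]; field_simp; ring
  have hterm : ∀ i ∈ range ℓ, s ^ i - 1 ≤ Θ * ((s - 1) * i) := by
    intro i hi
    -- s^i − 1 = (s−1) Σ_{j<i} s^j ≤ (s−1) · i · s^ℓ... each s^j ≤ s^ℓ ≤ Θ (j ≤ ℓ)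
    have hg : (∑ j ∈ range i, s ^ j) * (s - 1) = s ^ i - 1 := geom_sum_mul s i
    have hle : ∑ j ∈ range i, s ^ j ≤ ∑ _j ∈ range i, Θ := Finset.sum_le_sum fun j hj => by
      have hji : j ≤ ℓ := ((mem_range.1 hj).le.trans (mem_range.1 hi).le)
      exact le_trans (pow_le_pow_right₀ hs1 hji) ht
    rw [Finset.sum_const, card_range, nsmul_eq_mul] at hle
    rw [← hg]
    have h1 : 0 ≤ s - 1 := by linarith
    nlinarith [mul_le_mul_of_nonneg_right hle h1]
  have hsum : ∑ i ∈ range ℓ, (s ^ i - 1) ≤ Θ * ((s - 1) * ∑ i ∈ range ℓ, (i : ℝ)) := by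
    rw [Finset.mul_sum, Finset.mul_sum]; exact Finset.sum_le_sum hterm
  have hI := sum_range_cast_le ℓ
  have h1 : 0 ≤ s - 1 := by linarith
  have hup : 1 + (s ^ ℓ - 1) / ℓ - s ≤ Θ * (s - 1) ^ 2 * ℓ / 2 := by
    rw [hid, div_le_iff₀ hℓpos]
    have := mul_le_mul_of_nonneg_left (le_trans hsum (mul_le_mul_of_nonneg_left (mul_le_mul_of_nonneg_left hI h1) (by linarith))) h1
    nlinarith [this]
  -- (s − 1) ℓ ≤ s^ℓ − 1 (G ≥ ℓ)
  have hG : (ℓ : ℝ) ≤ ∑ i ∈ range ℓ, s ^ i := by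
    calc (ℓ : ℝ) = ∑ _i ∈ range ℓ, (1 : ℝ) := hcard.symm
      _ ≤ _ := Finset.sum_le_sum fun i _ => one_le_pow₀ hs1
  have hkey : (s - 1) * ℓ ≤ s ^ ℓ - 1 := by
    have := mul_le_mul_of_nonneg_left hG h1; nlinarith [this, hgeom]
  have hsq : (s - 1) ^ 2 * (ℓ : ℝ) ^ 2 ≤ (s ^ ℓ - 1) ^ 2 := by
    calc (s - 1) ^ 2 * (ℓ : ℝ) ^ 2 = ((s - 1) * ℓ) ^ 2 := by ring
      _ ≤ (s ^ ℓ - 1) ^ 2 := pow_le_pow_left₀ (by positivity) hkey 2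
  calc 1 + (s ^ ℓ - 1) / ℓ - s ≤ Θ * (s - 1) ^ 2 * ℓ / 2 := hup
    _ = Θ * ((s - 1) ^ 2 * (ℓ : ℝ) ^ 2) / (2 * ℓ) := by field_simp
    _ ≤ Θ * (s ^ ℓ - 1) ^ 2 / (2 * ℓ) := by
        exact div_le_div_of_nonneg_right (mul_le_mul_of_nonneg_left hsq (by linarith)) (by positivity)

/-- FAR remainder: for `0 ≤ s ≤ 1` with `s^ℓ ≤ θ₀ ≤ 1`: `(s^ℓ)²·(1 − s) ≤ θ₀²(log(1/θ₀) + 1/4)/ℓ` (`1 − s ≤ −log s = log(1/t)/ℓ`,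
`t² log(1/t) ≤ t² log(1/θ₀) + tθ₀ − t²`). [folklore] -/
theorem affine_remainder_far {s θ₀ : ℝ} (hs : 0 ≤ s) (hs1 : s ≤ 1) (hθ : 0 < θ₀) (hθ1 : θ₀ ≤ 1) {ℓ : ℕ} (hℓ : 1 ≤ ℓ) (ht : s ^ ℓ ≤ θ₀) :
    (s ^ ℓ) ^ 2 * (1 - s) ≤ θ₀ ^ 2 * (Real.log (1 / θ₀) + 1 / 4) / ℓ := by
  have hℓpos : (0 : ℝ) < ℓ := by exact_mod_cast hℓ
  have hlog0 : 0 ≤ Real.log (1 / θ₀) := Real.log_nonneg (by rw [le_div_iff₀ hθ]; linarith)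
  rcases hs.eq_or_lt with h0 | hspos
  · subst h0
    rw [zero_pow (by omega)]; simp only [ne_eq, OfNat.ofNat_ne_zero, not_false_eq_true, zero_pow, zero_mul]
    positivity
  · set t := s ^ ℓ with htdef
    have htpos : 0 < t := pow_pos hspos _
    -- 1 − s ≤ −log s = log(1/t)/ℓ... −log s = −(log t)/ℓ
    have h1s : 1 - s ≤ -Real.log s := by
      have := Real.add_one_le_exp (Real.log s); rw [Real.exp_log hspos] at this; linarith
    have hlogs : Real.log s = Real.log t / ℓ := by rw [htdef, Real.log_pow, mul_div_cancel_left₀ _ hℓpos.ne']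
    -- −log t ≤ log(1/θ₀) + (θ₀/t − 1)
    have hlt : -Real.log t ≤ Real.log (1 / θ₀) + (θ₀ / t - 1) := by
      have h1 : Real.log (θ₀ / t) ≤ θ₀ / t - 1 := Real.log_le_sub_one_of_pos (by positivity)
      rw [Real.log_div hθ.ne' htpos.ne'] at h1
      rw [Real.log_div one_ne_zero hθ.ne', Real.log_one]
      linarith
    -- t² (1−s) ≤ t² (−log t)/ℓ ≤ (t² log(1/θ₀) + tθ₀ − t²)/ℓ ≤ θ₀²(log(1/θ₀) + 1/4)/ℓ
    have ht2 : 0 ≤ t ^ 2 := sq_nonneg _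
    have step1 : t ^ 2 * (1 - s) ≤ t ^ 2 * (-Real.log t / ℓ) := by
      apply mul_le_mul_of_nonneg_left _ ht2
      rw [hlogs] at h1s; rw [neg_div]; exact h1s
    have step2 : t ^ 2 * (-Real.log t) ≤ t ^ 2 * Real.log (1 / θ₀) + t * θ₀ - t ^ 2 := by
      have := mul_le_mul_of_nonneg_left hlt ht2
      have hid : t ^ 2 * (Real.log (1 / θ₀) + (θ₀ / t - 1)) = t ^ 2 * Real.log (1 / θ₀) + t * θ₀ - t ^ 2 := by field_simp; ring
      linarith [hid]
    have step3 : t ^ 2 * Real.log (1 / θ₀) + t * θ₀ - t ^ 2 ≤ θ₀ ^ 2 * (Real.log (1 / θ₀) + 1 / 4) := by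
      have hA : t ^ 2 * Real.log (1 / θ₀) ≤ θ₀ ^ 2 * Real.log (1 / θ₀) :=
        mul_le_mul_of_nonneg_right (pow_le_pow_left₀ htpos.le ht 2) hlog0
      nlinarith [sq_nonneg (t - θ₀ / 2)]
    calc t ^ 2 * (1 - s) ≤ t ^ 2 * (-Real.log t / ℓ) := step1
      _ = t ^ 2 * (-Real.log t) / ℓ := by ring
      _ ≤ (t ^ 2 * Real.log (1 / θ₀) + t * θ₀ - t ^ 2) / ℓ := div_le_div_of_nonneg_right step2 hℓpos.le
      _ ≤ θ₀ ^ 2 * (Real.log (1 / θ₀) + 1 / 4) / ℓ := div_le_div_of_nonneg_right step3 hℓpos.le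

/-- ★ CROSS-POINTWISE: for `Θ ≥ 1`, `0 ≤ s` with `t = s^ℓ ≤ Θ`, and `ρ ≥ 1/(4Θ)`:
`t²·|s − 1 − (t−1)/ℓ| ≤ (1/ℓ)·(32Θ² t²(t−1)² + 8Θ (t−ρ)²)`. [folklore] -/
theorem cross_pointwise {s ρ Θ : ℝ} (hs : 0 ≤ s) (hΘ : 1 ≤ Θ) {ℓ : ℕ} (hℓ : 1 ≤ ℓ) (ht : s ^ ℓ ≤ Θ) (hρ : 1 / (4 * Θ) ≤ ρ) :
    (s ^ ℓ) ^ 2 * |s - 1 - (s ^ ℓ - 1) / ℓ| ≤ (32 * Θ ^ 2 * ((s ^ ℓ) ^ 2 * (s ^ ℓ - 1) ^ 2) + 8 * Θ * (s ^ ℓ - ρ) ^ 2) / ℓ := by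
  have hℓpos : (0 : ℝ) < ℓ := by exact_mod_cast hℓ
  have hΘpos : 0 < Θ := by linarith
  set θ₀ : ℝ := 1 / (8 * Θ) with hθ₀
  have hθ₀pos : 0 < θ₀ := by positivity
  have hθ₀le : θ₀ ≤ 1 / 8 := by
    rw [hθ₀, div_le_div_iff_of_pos_left one_pos (by positivity) (by norm_num)]; linarith
  -- sign: E := s − 1 − (t−1)/ℓ ≤ 0
  have hE : s - 1 - (s ^ ℓ - 1) / ℓ ≤ 0 := by linarith [root_le_tangent hs hℓ]
  rw [abs_of_nonpos hE]
  have hA : 0 ≤ 32 * Θ ^ 2 * ((s ^ ℓ) ^ 2 * (s ^ ℓ - 1) ^ 2) := by positivity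
  have hB : 0 ≤ 8 * Θ * (s ^ ℓ - ρ) ^ 2 := by positivity
  rcases le_or_gt θ₀ (s ^ ℓ) with hnear | hfar
  · -- near/up: −E ≤ 32Θ² (t−1)²/ℓ
    have hrem : -(s - 1 - (s ^ ℓ - 1) / ℓ) ≤ 32 * Θ ^ 2 * (s ^ ℓ - 1) ^ 2 / ℓ := by
      rcases le_or_gt s 1 with hs1 | hs1
      · have h := affine_remainder_below hs hs1 hθ₀pos hℓ hnear
        have hid : (s ^ ℓ - 1) ^ 2 / (2 * ℓ * θ₀ ^ 2) = 32 * Θ ^ 2 * (s ^ ℓ - 1) ^ 2 / ℓ := by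
          rw [hθ₀]; field_simp; ring
        linarith [hid]
      · have h := affine_remainder_above hs1.le hℓ ht
        have h2 : Θ * (s ^ ℓ - 1) ^ 2 / (2 * ℓ) ≤ 32 * Θ ^ 2 * (s ^ ℓ - 1) ^ 2 / ℓ := by
          rw [div_le_div_iff₀ (by positivity) hℓpos]
          have : Θ ≤ 32 * Θ ^ 2 * 2 := by nlinarith
          nlinarith [mul_le_mul_of_nonneg_right this (by positivity : (0:ℝ) ≤ (s ^ ℓ - 1) ^ 2 * ℓ)]
        linarith
    have ht2 : 0 ≤ (s ^ ℓ) ^ 2 := sq_nonneg _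
    calc (s ^ ℓ) ^ 2 * -(s - 1 - (s ^ ℓ - 1) / ℓ) ≤ (s ^ ℓ) ^ 2 * (32 * Θ ^ 2 * (s ^ ℓ - 1) ^ 2 / ℓ) :=
          mul_le_mul_of_nonneg_left hrem ht2
      _ = 32 * Θ ^ 2 * ((s ^ ℓ) ^ 2 * (s ^ ℓ - 1) ^ 2) / ℓ := by ring
      _ ≤ _ := by rw [div_le_div_iff_of_pos_right hℓpos]; linarith
  · -- far: t < θ₀ ≤ 1/8: s ≤ 1, and −E ≤ 1 − s
    have hs1 : s ≤ 1 := by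
      rcases le_or_gt s 1 with h | h
      · exact h
      · have : (1 : ℝ) ≤ s ^ ℓ := one_le_pow₀ h.le
        linarith
    have hE2 : -(s - 1 - (s ^ ℓ - 1) / ℓ) ≤ 1 - s := by
      have : (s ^ ℓ - 1) / ℓ ≤ 0 := div_nonpos_of_nonpos_of_nonneg (by nlinarith [pow_le_one₀ hs hs1 (n := ℓ)]) hℓpos.le
      have h2 : 0 ≤ -(s ^ ℓ - 1) / ℓ := by rw [neg_div]; linarith
      -- −E = 1 − s + (t−1)/ℓ ≤ 1 − s
      linarith
    have hfarb := affine_remainder_far hs hs1 hθ₀pos (by linarith) hℓ hfar.le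
    -- θ₀²(log(1/θ₀) + 1/4) ≤ θ₀² · 8Θ  and θ₀² ≤ (t − ρ)²
    have hlog : Real.log (1 / θ₀) + 1 / 4 ≤ 8 * Θ := by
      have h1 : Real.log (1 / θ₀) ≤ 1 / θ₀ - 1 := Real.log_le_sub_one_of_pos (by positivity)
      have h2 : 1 / θ₀ = 8 * Θ := by rw [hθ₀]; field_simp
      linarith
    have hgap : θ₀ ^ 2 ≤ (s ^ ℓ - ρ) ^ 2 := by
      have h1 : θ₀ ≤ ρ - s ^ ℓ := by
        have : 2 * θ₀ = 1 / (4 * Θ) := by rw [hθ₀]; field_simp; ring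
        linarith
      calc θ₀ ^ 2 ≤ (ρ - s ^ ℓ) ^ 2 := pow_le_pow_left₀ hθ₀pos.le h1 2
        _ = (s ^ ℓ - ρ) ^ 2 := by ring
    calc (s ^ ℓ) ^ 2 * -(s - 1 - (s ^ ℓ - 1) / ℓ) ≤ (s ^ ℓ) ^ 2 * (1 - s) := mul_le_mul_of_nonneg_left hE2 (sq_nonneg _)
      _ ≤ θ₀ ^ 2 * (Real.log (1 / θ₀) + 1 / 4) / ℓ := hfarb
      _ ≤ θ₀ ^ 2 * (8 * Θ) / ℓ := div_le_div_of_nonneg_right (mul_le_mul_of_nonneg_left hlog (sq_nonneg _)) hℓpos.le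
      _ ≤ (s ^ ℓ - ρ) ^ 2 * (8 * Θ) / ℓ := div_le_div_of_nonneg_right (mul_le_mul_of_nonneg_right hgap (by positivity)) hℓpos.le
      _ = 8 * Θ * (s ^ ℓ - ρ) ^ 2 / ℓ := by ring
      _ ≤ _ := by rw [div_le_div_iff_of_pos_right hℓpos]; linarith

end Root

/-! ## §2 ★★ The cross door for two once-dressed vectors -/

namespace Root

/-- PER-ATOM CROSS BOUND (clean context): with `y = x^ℓ`, `t = y/X₀`, `X₀ = m̄^ℓ`, `t ≤ Θ`, raw-mean ratios `≥ 1/(4Θ)`: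
`|y²·ab·(x − m̄ − (m̄/(ℓX₀))(y − X₀))| ≤ (m̄/(2ℓ))·(τ·(32Θ²/X₀²·y²a²(y−X₀)² + 8Θ·a²(y−m_a)²) + (…b…)/τ)`. [folklore] -/
theorem cross_term_bound {x a b mb X0 ma mb' Θ τ : ℝ} {ℓ : ℕ} (hx : 0 ≤ x) (hmb : 0 < mb) (hX0 : X0 = mb ^ ℓ) (hΘ : 1 ≤ Θ)
    (hℓ : 1 ≤ ℓ) (htop : x ^ ℓ ≤ Θ * X0) (hρa : 1 / (4 * Θ) ≤ ma / X0) (hρb : 1 / (4 * Θ) ≤ mb' / X0) (hτ : 0 < τ) :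
    |(x ^ ℓ) ^ 2 * (a * b) * (x - mb - mb / (ℓ * X0) * (x ^ ℓ - X0))| ≤
      mb / (2 * ℓ) *
        (τ * (32 * Θ ^ 2 / X0 ^ 2 * ((x ^ ℓ) ^ 2 * a ^ 2 * (x ^ ℓ - X0) ^ 2) + 8 * Θ * (a ^ 2 * (x ^ ℓ - ma) ^ 2)) +
          (32 * Θ ^ 2 / X0 ^ 2 * ((x ^ ℓ) ^ 2 * b ^ 2 * (x ^ ℓ - X0) ^ 2) + 8 * Θ * (b ^ 2 * (x ^ ℓ - mb') ^ 2)) / τ) := by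
  have hℓpos : (0 : ℝ) < ℓ := by exact_mod_cast hℓ
  have hX0pos : 0 < X0 := by rw [hX0]; exact pow_pos hmb _
  have hs : 0 ≤ x / mb := div_nonneg hx hmb.le
  have hsl : (x / mb) ^ ℓ = x ^ ℓ / X0 := by rw [div_pow, hX0]
  have htk : (x / mb) ^ ℓ ≤ Θ := by rw [hsl, div_le_iff₀ hX0pos]; exact htop
  have hpa := cross_pointwise hs hΘ hℓ htk hρa
  have hpb := cross_pointwise hs hΘ hℓ htk hρb
  rw [hsl] at hpa hpb
  set y := x ^ ℓ with hy
  set E := x / mb - 1 - (y / X0 - 1) / ℓ with hE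
  -- the term as (ab) · (c · E), c = X0² mb (y/X0)² ≥ 0
  have hc : 0 ≤ X0 ^ 2 * mb * (y / X0) ^ 2 := by positivity
  have hf : y ^ 2 * (a * b) * (x - mb - mb / (ℓ * X0) * (y - X0)) = (a * b) * ((X0 ^ 2 * mb * (y / X0) ^ 2) * E) := by
    rw [hE]; field_simp
  rw [hf, abs_mul (a * b), abs_mul (X0 ^ 2 * mb * (y / X0) ^ 2) E, abs_of_nonneg hc]
  have hamgm := abs_mul_le_amgm hτ a b
  -- (y/X0)²|E| ≤ bounds; multiply out
  have hP0 : 0 ≤ (y / X0) ^ 2 * |E| := by positivity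
  have hA1 : X0 ^ 2 * ((y / X0) ^ 2 * |E|) * a ^ 2 ≤
      (32 * Θ ^ 2 / X0 ^ 2 * (y ^ 2 * a ^ 2 * (y - X0) ^ 2) + 8 * Θ * (a ^ 2 * (y - ma) ^ 2)) / ℓ := by
    have h1 := mul_le_mul_of_nonneg_right (mul_le_mul_of_nonneg_left hpa (sq_nonneg X0)) (sq_nonneg a)
    have hid : X0 ^ 2 * ((32 * Θ ^ 2 * ((y / X0) ^ 2 * (y / X0 - 1) ^ 2) + 8 * Θ * (y / X0 - ma / X0) ^ 2) / ℓ) * a ^ 2 =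
        (32 * Θ ^ 2 / X0 ^ 2 * (y ^ 2 * a ^ 2 * (y - X0) ^ 2) + 8 * Θ * (a ^ 2 * (y - ma) ^ 2)) / ℓ := by
      field_simp
    rw [hid] at h1; exact h1
  have hB1 : X0 ^ 2 * ((y / X0) ^ 2 * |E|) * b ^ 2 ≤
      (32 * Θ ^ 2 / X0 ^ 2 * (y ^ 2 * b ^ 2 * (y - X0) ^ 2) + 8 * Θ * (b ^ 2 * (y - mb') ^ 2)) / ℓ := by
    have h1 := mul_le_mul_of_nonneg_right (mul_le_mul_of_nonneg_left hpb (sq_nonneg X0)) (sq_nonneg b)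
    have hid : X0 ^ 2 * ((32 * Θ ^ 2 * ((y / X0) ^ 2 * (y / X0 - 1) ^ 2) + 8 * Θ * (y / X0 - mb' / X0) ^ 2) / ℓ) * b ^ 2 =
        (32 * Θ ^ 2 / X0 ^ 2 * (y ^ 2 * b ^ 2 * (y - X0) ^ 2) + 8 * Θ * (b ^ 2 * (y - mb') ^ 2)) / ℓ := by
      field_simp
    rw [hid] at h1; exact h1
  have hcE : 0 ≤ X0 ^ 2 * mb * (y / X0) ^ 2 * |E| := by positivity
  calc |a * b| * (X0 ^ 2 * mb * (y / X0) ^ 2 * |E|)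
      ≤ (τ * a ^ 2 + b ^ 2 / τ) / 2 * (X0 ^ 2 * mb * (y / X0) ^ 2 * |E|) := mul_le_mul_of_nonneg_right hamgm hcE
    _ = mb / 2 * (τ * (X0 ^ 2 * ((y / X0) ^ 2 * |E|) * a ^ 2) + (X0 ^ 2 * ((y / X0) ^ 2 * |E|) * b ^ 2) / τ) := by
        field_simp
    _ ≤ mb / 2 * (τ * ((32 * Θ ^ 2 / X0 ^ 2 * (y ^ 2 * a ^ 2 * (y - X0) ^ 2) + 8 * Θ * (a ^ 2 * (y - ma) ^ 2)) / ℓ) +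
          ((32 * Θ ^ 2 / X0 ^ 2 * (y ^ 2 * b ^ 2 * (y - X0) ^ 2) + 8 * Θ * (b ^ 2 * (y - mb') ^ 2)) / ℓ) / τ) := by
        apply mul_le_mul_of_nonneg_left _ (by positivity)
        exact add_le_add (mul_le_mul_of_nonneg_left hA1 hτ.le) (div_le_div_of_nonneg_right hB1 hτ.le)
    _ = _ := by field_simp

/-- BOUNDING THE DOMINATING SUM by the defects (clean context). [folklore] -/
theorem cross_major_bound {Na Ta Qa Ra Aa ma X0 Θ δ : ℝ} (hNa0 : 0 < Na) (hX0 : 0 < X0) (hΘ : 0 ≤ Θ) (hδ0 : 0 ≤ δ)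
    (hv2 : Qa - 2 * (Ta / Na) * Ta + (Ta / Na) ^ 2 * Na ≤ δ * ((Ta / Na) ^ 2 * Na))
    (hv1 : Na - 2 * ma * Ra + ma ^ 2 * Aa ≤ δ * Na) (hXa1 : Ta / Na ≤ Θ * X0) (hXa0 : 0 ≤ Ta / Na) :
    32 * Θ ^ 2 / X0 ^ 2 * (Qa - 2 * X0 * Ta + X0 ^ 2 * Na) + 8 * Θ * (Na - 2 * ma * Ra + ma ^ 2 * Aa) ≤
      Na * ((32 * Θ ^ 4 + 8 * Θ) * δ + 32 * Θ ^ 2 * (Ta / Na / X0 - 1) ^ 2) := by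
  have hsplit : Qa - 2 * X0 * Ta + X0 ^ 2 * Na = (Qa - 2 * (Ta / Na) * Ta + (Ta / Na) ^ 2 * Na) + Na * (Ta / Na - X0) ^ 2 := by
    field_simp; ring
  have hXsq : (Ta / Na) ^ 2 ≤ Θ ^ 2 * X0 ^ 2 := by rw [← mul_pow]; exact pow_le_pow_left₀ hXa0 hXa1 2
  have h1 : Qa - 2 * (Ta / Na) * Ta + (Ta / Na) ^ 2 * Na ≤ δ * (Θ ^ 2 * X0 ^ 2 * Na) :=
    le_trans hv2 (mul_le_mul_of_nonneg_left (mul_le_mul_of_nonneg_right hXsq hNa0.le) hδ0)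
  have hc : 0 ≤ 32 * Θ ^ 2 / X0 ^ 2 := by positivity
  have h2 := mul_le_mul_of_nonneg_left h1 hc
  have hid1 : 32 * Θ ^ 2 / X0 ^ 2 * (δ * (Θ ^ 2 * X0 ^ 2 * Na)) = Na * (32 * Θ ^ 4 * δ) := by field_simp
  have hid2 : 32 * Θ ^ 2 / X0 ^ 2 * (Na * (Ta / Na - X0) ^ 2) = Na * (32 * Θ ^ 2 * (Ta / Na / X0 - 1) ^ 2) := by field_simp
  have h3 := mul_le_mul_of_nonneg_left hv1 (by positivity : (0 : ℝ) ≤ 8 * Θ)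
  rw [hsplit, mul_add, hid2]
  nlinarith [h2, hid1, h3]

end Root


end Summit.QuantumFields.YangMills.Theorems.FemtoTransferGap.SpecSum

end
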